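import Literature.NumberTheory.Automorphic.UnitaryOrbitalIntegralSimilitudeTransport   -- ★ `coe_localNonsplitEquiv_cmDatumLocalNonsplitCongr(_symm)`, ★ `isRegularElt_cmDatumLocalNonsplitCongr_iff` (the similitude `Ad T`)
import Literature.NumberTheory.Automorphic.UnitaryUnitOrbitalIntegralLatticeCount   -- ★ `natCard_fixedBy_quotient_congr` (fixed cosets transport along `≃*`)
import HarnessLib

/-!
# Similitude transport of fixed cosets on `U(H)(L⁺_v)`: `#Fix(U ⧸ C_{T S T⁻¹}, γ) = #Fix(U ⧸ C_S, T⁻¹ γ T)`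

Companion of ★ `UnitaryOrbitalIntegralSimilitudeTransport` on the ELLIPTIC side of Kottwitz's Euler–Poincaré computation
[Kottwitz1988, §2]: for `L` CM, `w ∣ v` non-split, a local similitude `T ∈ GL_N(L_w)` of `H_w` (`ᵗ(σ_w T) H_w T = a H_w`,
`a ≠ 0`; NO `σ_w a = a` needed here — this is pure group theory) and `e_T = Ad T` (★ `cmDatumLocalNonsplitCongr`), and two
subgroups `C, C′ ≤ U(H)(L⁺_v)` cut out by ambient levels `S` and `T S T⁻¹` of `GL_N(L_w)` (`γ ∈ C ↔ γ_w ∈ S`,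
`γ ∈ C′ ↔ γ_w ∈ T S T⁻¹` — e.g. the (R2) tokens `K = U ∩ GL₂(𝒪_w)` and `K′ = U ∩ d GL₂(𝒪_w) d⁻¹`, `d = diag(1, ϖ)`, pulled back
along ★ `localNonsplitEquiv`): `e_T` induces `U ⧸ C ≃ U ⧸ C′` matching `Fix(γ)` with `Fix(e_T γ)` (★ `natCard_fixedBy_quotient_congr`),
so **`#Fix(U ⧸ C′, γ) = #Fix(U ⧸ C, e_T⁻¹ γ)`** with `(e_T⁻¹ γ)_w = T⁻¹ γ_w T` — the number of `γ`-fixed `ϖ`-MODULAR vertices is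
the number of `d⁻¹ γ d`-fixed SELF-DUAL vertices [Rogawski1990, §12.6 p. 174] — and regularity ∕ compactness of the
centraliser are the same at `γ` and `e_T⁻¹ γ`.
-/

noncomputable section

open MeasureTheory Measure Topology Filter Set NumberField IsDedekindDomain
open scoped Matrix MatrixGroups

namespace Literature.NumberTheory.Automorphic.UnitaryGroup

open Literature.NumberTheory.Rogawski1990 (IsRegularElt)

section CM

variable (L : Type) [Field L] [NumberField L] [IsCMField L] (N : ℕ) (H : Matrix (Fin N) (Fin N) L)
  {v : HeightOneSpectrum (𝓞 ↥(maximalRealSubfield L))}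
  (w : PlacesOver L v) (hw : IsCMField.complexConj L • w.1 = w.1)
  (T : GL (Fin N) (w.1.adicCompletion L)) {a : w.1.adicCompletion L} (ha : IsUnit a)
  (h : formCongr (galAdicCompletionMap (L := L) (IsCMField.complexConj L) hw) T (placeForm H w.1) = a • placeForm H w.1)
  (S : Subgroup (GL (Fin N) (w.1.adicCompletion L))) (C C' : Subgroup ((cmDatum L N H).Local v))
  (hC : ∀ g : (cmDatum L N H).Local v, g ∈ C ↔
    ((localNonsplitEquiv (IsCMField.complexConj L) H (IsCMField.complexConj_ne_one L) w hw g :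
      unitaryGroupOfForm (galAdicCompletionMap (L := L) (IsCMField.complexConj L) hw) (placeForm H w.1)) :
      GL (Fin N) (w.1.adicCompletion L)) ∈ S)
  (hC' : ∀ g : (cmDatum L N H).Local v, g ∈ C' ↔
    ((localNonsplitEquiv (IsCMField.complexConj L) H (IsCMField.complexConj_ne_one L) w hw g :
      unitaryGroupOfForm (galAdicCompletionMap (L := L) (IsCMField.complexConj L) hw) (placeForm H w.1)) :
      GL (Fin N) (w.1.adicCompletion L)) ∈ S.map (MulAut.conj T).toMonoidHom)

include hC hC'

/-- **`γ ∈ C ↔ e_T γ ∈ C′`**: `Ad T` carries the level cut out by `S` onto the level cut out by `T S T⁻¹`. [cite: Kottwitz1988, §2]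
[cite: PlatonovRapinchuk1994, §2.3] -/
theorem mem_iff_cmDatumLocalNonsplitCongr_mem (g : (cmDatum L N H).Local v) :
    g ∈ C ↔ cmDatumLocalNonsplitCongr L w hw T ha h g ∈ C' := by
  rw [hC, hC', coe_localNonsplitEquiv_cmDatumLocalNonsplitCongr, Subgroup.mem_map_equiv, MulAut.conj_symm_apply,
    show T⁻¹ * (T * ((localNonsplitEquiv (IsCMField.complexConj L) H (IsCMField.complexConj_ne_one L) w hw g :
      unitaryGroupOfForm (galAdicCompletionMap (L := L) (IsCMField.complexConj L) hw) (placeForm H w.1)) :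
      GL (Fin N) (w.1.adicCompletion L)) * T⁻¹) * T = ((localNonsplitEquiv (IsCMField.complexConj L) H
        (IsCMField.complexConj_ne_one L) w hw g :
      unitaryGroupOfForm (galAdicCompletionMap (L := L) (IsCMField.complexConj L) hw) (placeForm H w.1)) :
      GL (Fin N) (w.1.adicCompletion L)) by group]

/-- **`#Fix(U ⧸ C, γ) = #Fix(U ⧸ C′, e_T γ)`** for every `γ ∈ U(H)(L⁺_v)` (★ `natCard_fixedBy_quotient_congr` along `e_T`).
[cite: Kottwitz1988, §2] [cite: Rogawski1990, §12.6 p. 174] -/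
theorem natCard_fixedBy_quotient_eq_natCard_fixedBy_quotient_cmDatumLocalNonsplitCongr (γ : (cmDatum L N H).Local v) :
    Nat.card (MulAction.fixedBy ((cmDatum L N H).Local v ⧸ C) γ) =
      Nat.card (MulAction.fixedBy ((cmDatum L N H).Local v ⧸ C') (cmDatumLocalNonsplitCongr L w hw T ha h γ)) :=
  natCard_fixedBy_quotient_congr C C' (cmDatumLocalNonsplitCongr L w hw T ha h).toMulEquiv
    (mem_iff_cmDatumLocalNonsplitCongr_mem L N H w hw T ha h S C C' hC hC') γ

/-- **HEAD — `#Fix(U ⧸ C′, γ) = #Fix(U ⧸ C, e_T⁻¹ γ)`**, `(e_T⁻¹ γ)_w = T⁻¹ γ_w T` (★ `coe_localNonsplitEquiv_cmDatumLocalNonsplitCongr_symm`):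
on `U(Φ₂)` with `S = GL₂(𝒪_w)`, `T = d = diag(1, ϖ)`: the `γ`-fixed `ϖ`-modular vertices (`Fix(U ⧸ K′)`) are counted by the
`d⁻¹ γ d`-fixed self-dual vertices (`Fix(U ⧸ K)`), i.e. by ★ `natCard_fixedBy_cmLocalIntegralLevel_eq_ncard_selfDualStable`-type
counts at the conjugate element. [cite: Kottwitz1988, §2] [cite: Rogawski1990, §12.6 p. 174] -/
theorem natCard_fixedBy_quotient_eq_natCard_fixedBy_quotient_cmDatumLocalNonsplitCongr_symm (γ : (cmDatum L N H).Local v) :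
    Nat.card (MulAction.fixedBy ((cmDatum L N H).Local v ⧸ C') γ) =
      Nat.card (MulAction.fixedBy ((cmDatum L N H).Local v ⧸ C) ((cmDatumLocalNonsplitCongr L w hw T ha h).symm γ)) := by
  rw [natCard_fixedBy_quotient_eq_natCard_fixedBy_quotient_cmDatumLocalNonsplitCongr L N H w hw T ha h S C C' hC hC',
    ContinuousMulEquiv.apply_symm_apply]

omit hC hC' in
/-- Regularity at `e_T⁻¹ γ` is regularity at `γ`. [cite: Rogawski1990, §3.1 p. 19] -/
theorem isRegularElt_cmDatumLocalNonsplitCongr_symm_iff (γ : (cmDatum L N H).Local v) :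
    IsRegularElt (((cmDatumLocalNonsplitCongr L w hw T ha h).symm γ).val : GL (Fin N) (LocalRing L v)) ↔
      IsRegularElt (γ.val : GL (Fin N) (LocalRing L v)) := by
  have h1 := isRegularElt_cmDatumLocalNonsplitCongr_iff L N H w hw T ha h ((cmDatumLocalNonsplitCongr L w hw T ha h).symm γ)
  rw [ContinuousMulEquiv.apply_symm_apply] at h1
  exact h1.symm

omit hC hC' in
/-- **Ellipticity is transported**: the centraliser of `e γ` is compact iff that of `γ` is, for every topological-group
automorphism `e` (here `e = e_T`; `Z(e γ) = e Z(γ)`). [cite: Rogawski1990, §12.6 p. 174] [cite: Kottwitz1988, §2] -/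
theorem compactSpace_centralizer_cmDatumLocalNonsplitCongr_iff (γ : (cmDatum L N H).Local v) :
    CompactSpace (Subgroup.centralizer ({cmDatumLocalNonsplitCongr L w hw T ha h γ} : Set ((cmDatum L N H).Local v))) ↔
      CompactSpace (Subgroup.centralizer ({γ} : Set ((cmDatum L N H).Local v))) := by
  set e := cmDatumLocalNonsplitCongr L w hw T ha h with he
  have hiff : ∀ x : (cmDatum L N H).Local v, x ∈ Subgroup.centralizer ({γ} : Set ((cmDatum L N H).Local v)) ↔
      e x ∈ Subgroup.centralizer ({e γ} : Set ((cmDatum L N H).Local v)) := fun x => by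
    rw [Subgroup.mem_centralizer_singleton_iff, Subgroup.mem_centralizer_singleton_iff, ← map_mul, ← map_mul,
      e.injective.eq_iff]
  refine ⟨fun hc => ?_, fun hc => ?_⟩
  · exact (e.toHomeomorph.subtype hiff).symm.compactSpace
  · exact (e.toHomeomorph.subtype hiff).compactSpace

end CM

end Literature.NumberTheory.Automorphic.UnitaryGroup

end
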